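import Summits.ResolutionOfSingularities.ResolutionOfSingularities.Theorems.PurelyInseparableDim4WinCertLeafSound
import Summits.ResolutionOfSingularities.ResolutionOfSingularities.Theorems.PurelyInseparableDim4ScopeBlindNormLeaf
import HarnessLib
import HarnessLib.Audit.Tags

/-!
# Purely inseparable fourfolds — FCert v3 («LCert»): the LEAF ORACLE for the landed leaf kinds at `p = 2` —
# SUBSTITUTION leaves (res-dim4-p-8 g3's `substBlindB`) and NORM leaves (p-8's `normLeafB`) — and its soundness
# [OURS · counted 0 · a certificate format for OUR frame v4, not about resolution]

Census cell «res-dim4-pi» (D-0157 DOOR 2), desk WORDS #111 (b) / #113 (d); seat res-rescue-typ-3 g9.  Sequel of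
`…WinCertLeaf` / `…WinCertLeafSound` (kind-agnostic checker `lwinCertBL p q leafOK`, `LeafSound`,
`forall_inScopeStateWins_of_lwinCertBL`).  THIS FILE instantiates the oracle for the two leaf kinds whose blindness
lemmas are in the tree (one-owner line of WORD #111 (b): the LEMMAS are p-8's, the checker is this seat's):

* `LeafCert k` — `subst σ T α₀` (the leaf `{b : σ(b) = b}`, p-8's `…ScopeBlindSubstCert`) | `norm T u v α₀` (the
  𝔽₄-conjugate plane pair `{b_T = 0, b_u² + b_u b_v + b_v² = 0}`, p-8's `…ScopeBlindNormLeaf`, `p = 2`).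
* `leafOK2 s S ℓ` — no open conditions; the kind's Boolean certificate on the chart of `ℓ`; and the SYNTACTIC LINK
  between the leaf's closed conditions `ℓ.gens` and the kind's hypothesis: for `subst`, every coordinate has `σ_i = x_i`
  verbatim, or is the chart variable with `σ_j = 0`, or `σ_i − x_i ∈ gens` (`WinCertSubst.subL`); for `norm`, `x_t ∈ gens`
  for every `t ∈ T` other than the chart variable, and `x_u² + x_u x_v + x_v² ∈ gens` (`normTermsL`).
* **`leafSound2 : LeafSound 2 leafOK2`** — by p-8's `not_inCoordinateScope_step_map_of_substBlindB` /
  `children_blind_of_normLeafB`.  Hence data files check `lwinCertBL 2 2 leafOK2 T = true` by `decide` and conclude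
  with `forall_inScopeStateWins_of_lwinCertBL leafSound2`.
Nothing here proves resolution of singularities in dimension ≥ 4 / characteristic `p`; F4-C(2,2) stays OPEN; counted 0;
AI work, weaker than expert review.  bears_on: LADDER-RESOLUTION:D157-DOOR2 (res-dim4-pi · F4-C ∀K column · FCert v3
leaf kinds). Supports stmt-ResolutionOfSingularities-16155 (helper).
-/

set_option linter.dupNamespace false

noncomputable section
open MvPolynomial Finset
open scoped BigOperators
namespace Summit.ResolutionOfSingularities.ResolutionOfSingularities.Theorems.PIDim4

namespace WinCertLeaf

open Literature.AlgebraicGeometry.Resolution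
open Literature.AlgebraicGeometry.Resolution.CentreBlowup
open StepKit WinCertSound InScopeWinCert ScopeCover ScopeBlind WinCertAllFields WinCertFlat WinCertSubst

/-! ## 1. The certificates of the landed kinds -/

/-- A leaf certificate of a landed kind: a SUBSTITUTION leaf `(σ, T, α₀)` or (at `p = 2`) a NORM leaf `(T, u, v, α₀)`.
[folklore] -/
inductive LeafCert (k : Type) where
  /-- p-8's substitution leaf: `σ` kills `J_q⁺` of the chart transform, `σ_T = 0`, `α₀` the uniform non-vanishing -/
  | subst (σ : Fin 4 → Terms 4 k) (T : Finset (Fin 4)) (α₀ : Fin 4 → ℕ) : LeafCert k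
  /-- p-8's norm leaf: the conjugate plane pair `x_T = 0`, `x_u = ω x_v` / `x_u = ω² x_v` -/
  | norm (T : Finset (Fin 4)) (u v : Fin 4) (α₀ : Fin 4 → ℕ) : LeafCert k

variable {k : Type} [Field k] [DecidableEq k]

/-- The term list of `x_u² + x_u x_v + x_v²`. [folklore] -/
def normTermsL (u v : Fin 4) : Terms 4 k := [(unitE u 2, 1), (unitE u 1 + unitE v 1, 1), (unitE v 2, 1)]

omit [DecidableEq k] in
/-- `eval₂Hom f b (x_u² + x_u x_v + x_v²) = b_u² + b_u b_v + b_v²`. [folklore] -/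
theorem eval₂Hom_normTermsL {K : Type} [Field K] (f : k →+* K) (b : Fin 4 → K) (u v : Fin 4) :
    eval₂Hom f b (evalT (normTermsL (k := k) u v)) = b u ^ 2 + b u * b v + b v ^ 2 := by
  have hprod : ∏ l, b l ^ (unitE u 1 + unitE v 1) l = b u * b v := by
    simp only [Pi.add_apply, pow_add, Finset.prod_mul_distrib, prod_pow_unitE, pow_one]
  simp only [normTermsL, evalT_cons, evalT_nil, map_add, add_zero, eval₂Hom_monomial_expo, prod_pow_unitE, map_one,
    one_mul, hprod]
  ring

/-- **The syntactic link for a substitution leaf**: every coordinate has `σ_i = x_i` verbatim, or is the chart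
variable with `σ_j = 0` verbatim, or `σ_i − x_i` is one of the leaf's closed conditions. [folklore] -/
def substLinkB {C : Type} (ℓ : ILeaf k C) (σ : Fin 4 → Terms 4 k) : Bool :=
  decide (∀ i : Fin 4, σ i = [(unitE i 1, 1)] ∨ (i = ℓ.j ∧ σ i = []) ∨ subL (σ i, i) ∈ ℓ.gens)

/-- **The syntactic link for a norm leaf**: `x_t ∈ gens` for `t ∈ T` other than the chart variable, and
`x_u² + x_u x_v + x_v² ∈ gens`. [folklore] -/
def normLinkB {C : Type} (ℓ : ILeaf k C) (T : Finset (Fin 4)) (u v : Fin 4) : Bool :=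
  decide (∀ t ∈ T, t = ℓ.j ∨ ([(unitE t 1, (1 : k))] : Terms 4 k) ∈ ℓ.gens) && decide (normTermsL u v ∈ ℓ.gens)

/-- **THE LEAF ORACLE at `p = 2`** for the landed kinds. [folklore] -/
def leafOK2 (s : SData 4 (ZMod 2)) (S : Finset (Fin 4)) (ℓ : ILeaf (ZMod 2) (LeafCert (ZMod 2))) : Bool :=
  match ℓ.cert with
  | .subst σ T α₀ => ℓ.opens.isEmpty && substLinkB ℓ σ && substBlindB 2 (chartL 2 S ℓ.j s.L) σ T α₀
  | .norm T u v α₀ => ℓ.opens.isEmpty && normLinkB ℓ T u v && normLeafB s S ℓ.j T u v α₀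

/-! ## 2. Soundness of the oracle -/

omit [DecidableEq k] in
/-- From the substitution link and the closed conditions: `b` is fixed by `σ ⊗ K`. [folklore] -/
theorem eval_map_eq_of_substLinkB {C : Type} {K : Type} [Field K] (f : k →+* K) {ℓ : ILeaf k C}
    {σ : Fin 4 → Terms 4 k} [DecidableEq k] (hlink : substLinkB ℓ σ = true) {b : Fin 4 → K} (hbj : b ℓ.j = 0)
    (hon : OnLeaf f ℓ b) (i : Fin 4) : MvPolynomial.eval b (MvPolynomial.map f (evalT (σ i))) = b i := by
  classical
  rw [MvPolynomial.eval_map, ← MvPolynomial.coe_eval₂Hom]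
  unfold substLinkB at hlink
  rcases of_decide_eq_true hlink i with h | ⟨rfl, h⟩ | h
  · rw [h, eval₂Hom_X_terms]
  · rw [h, evalT_nil, map_zero, hbj]
  · have hz := hon.1 _ h
    rw [eval₂Hom_subL] at hz
    exact sub_eq_zero.mp hz

omit [DecidableEq k] in
/-- From the norm link and the closed conditions: `b_T = 0` and `b_u² + b_u b_v + b_v² = 0`. [folklore] -/
theorem norm_hyps_of_normLinkB {C : Type} {K : Type} [Field K] (f : k →+* K) {ℓ : ILeaf k C}
    {T : Finset (Fin 4)} {u v : Fin 4} [DecidableEq k] (hlink : normLinkB ℓ T u v = true) {b : Fin 4 → K}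
    (hbj : b ℓ.j = 0) (hon : OnLeaf f ℓ b) :
    (∀ i ∈ T, b i = 0) ∧ b u ^ 2 + b u * b v + b v ^ 2 = 0 := by
  classical
  unfold normLinkB at hlink
  rw [Bool.and_eq_true, decide_eq_true_eq, decide_eq_true_eq] at hlink
  refine ⟨fun i hi => ?_, ?_⟩
  · rcases hlink.1 i hi with rfl | h
    · exact hbj
    · have hz := hon.1 _ h
      rwa [eval₂Hom_X_terms] at hz
  · have hz := hon.1 _ hlink.2
    rwa [eval₂Hom_normTermsL] at hz

/-- **SOUNDNESS OF THE ORACLE**: `leafOK2` is a sound leaf oracle at `p = 2`. [folklore] -/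
theorem leafSound2 : LeafSound 2 leafOK2 := by
  classical
  intro s S ℓ hok K _ _ _ f b hbj hon
  obtain ⟨j, gens, opens, cert⟩ := ℓ
  cases cert with
  | subst σ T α₀ =>
    simp only [leafOK2, Bool.and_eq_true] at hok
    obtain ⟨⟨-, hlink⟩, hsub⟩ := hok
    exact not_inCoordinateScope_step_map_of_substBlindB hsub K f b (eval_map_eq_of_substLinkB f hlink hbj hon)
  | norm T u v α₀ =>
    simp only [leafOK2, Bool.and_eq_true] at hok
    obtain ⟨⟨-, hlink⟩, hnorm⟩ := hok
    obtain ⟨hT, hQ⟩ := norm_hyps_of_normLinkB f hlink hbj hon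
    have hf : f = ZMod.castHom (dvd_refl 2) K := Subsingleton.elim _ _
    subst hf
    exact children_blind_of_normLeafB hnorm K b hT hQ

/-- **`∀ K` form for the landed kinds**: every row state of a certificate passing `lwinCertBL 2 2 leafOK2` is IN-SCOPE
ESCAPABLE over every field of characteristic 2. [folklore] -/
theorem forall_inScopeStateWins_of_lwinCertBL2 {T : LCert (ZMod 2) (LeafCert (ZMod 2))}
    (h : lwinCertBL 2 2 leafOK2 T = true) (K : Type) [Field K] [CharP K 2] [DecidableEq K] :
    ∀ row ∈ T, InScopeStateWins 2
      (⟨MvPolynomial.map (ZMod.castHom (dvd_refl 2) K) row.1.1.toState.F, row.1.1.toState.r,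
        row.1.1.toState.exc⟩ : State K) :=
  forall_inScopeStateWins_of_lwinCertBL leafSound2 h K

end WinCertLeaf

end Summit.ResolutionOfSingularities.ResolutionOfSingularities.Theorems.PIDim4

end
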